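import Mathlib
import Summits.RiemannHypothesis.RiemannHypothesis.Theorems.HandoffRealZeroCount
import Summits.RiemannHypothesis.RiemannHypothesis.Theorems.HandoffXiZeroCount
import Summits.RiemannHypothesis.RiemannHypothesis.Theorems.HandoffCountThinReal
import Literature.NumberTheory.LFunctions.RiemannXiProofs
import Literature.NumberTheory.LFunctions.ZetaZeros
import Literature.Analysis.Complex.FourierPolyaKiKimEngine
import HarnessLib

/-!
# ROUTE R-K «COUNT-AND-THIN»: the count law may be ONE-SIDED — a LOWER bound `≥ N(T)` suffices

Handoff track (ROUTE 1′), prove-1 gen13; companion of `HandoffCountThin*.lean` (idea-3 gen22 ROUTE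
R-K, TASK H-K1; HOME/handoff/IDEAS-finite-rank.md v3.3.1 §G22-3/§G22-4). Built imports only.

In the proof of G22-T the count law SC-2 («eventually `#{x ∈ (0,T] : û_t(x) = 0} = N(T)`») is used
only through the inequality `N(T) ≤ #`: the reverse inequality (indeed `# ≤ N₀(T) ≤ N(T)`) is a
CONSEQUENCE of the convergence near the axis (Rolle; `HandoffCountThinWindow`). This file records the
resulting sharper criterion, in which SC-2 is replaced by the LOWER COUNT
«eventually `#{x ∈ (0,T] : û_t(x) = 0} ≥ N(T)`» — a Levinson-type statement (the approximants have
AT LEAST as many real zeros in `(0, T]` as `ζ` has zeros up to height `T`), with no exactness, no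
simplicity and no ordinate proviso in the hypothesis:

* `im_eq_zero_of_countGe_of_smoothConvergence` — one window, real `C^{N(T)}` approximants;
* `im_eq_zero_of_countGe_of_nhds`, `riemannHypothesis_of_frequently_countGe_of_nhds` — entire
  families real on `ℝ`, convergence locally uniformly near `[0, T]`, lower count at unboundedly many `T`
  ⟹ `RiemannHypothesis`;
* `riemannHypothesis_of_frequently_countGe_of_thin` — the same from idea-3's thin rectangles (even
  families);
* `natCast_le_encard_zeros_of_sign_changes` — `N` sign changes of a continuous real function at points
  `0 < x₀ < x₁ < ⋯ < x_N ≤ T` give `≥ N` zeros in `(0, T]` (the form a census certifies), whence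
  `riemannHypothesis_of_frequently_signChanges_of_nhds`.

A pure implication between statements about an unspecified family and RH; nothing here is, or
suggests, a proof of RH.
-/

set_option linter.dupNamespace false  -- the mandated namespace repeats `RiemannHypothesis`

noncomputable section

open Filter Set Topology Metric Complex
open scoped BigOperators
open Literature.NumberTheory.LFunctions Literature.Analysis.Complex.KiKim

namespace Summit.RiemannHypothesis.RiemannHypothesis.Theorems

namespace CountThin

open RealZeroCount

/-- **One window, lower count, real-axis form.** Let `g_t : ℝ → ℝ` be eventually `C^{N(T)}` with
eventually `#{x ∈ (0, T] : g_t(x) = 0} ≥ N(T)` and `g_t^{(k)} → (x ↦ Ξ(x))^{(k)}` uniformly on `[0, T]`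
for every `k ≤ N(T)`. Then every zero of `Ξ` with `0 < Re z ≤ T` is real. (The real zero count is
upper semicontinuous in the hull form `RealZeroCount.eventually_ncard_zeros_le`: eventually
`# ≤ Σ_{real zeros of Ξ in [0,T]} ord ≤ N(T)`, the last with equality iff no zero of the box is
non-real.) -/
theorem im_eq_zero_of_countGe_of_smoothConvergence {g : ℝ → ℝ → ℝ} {T : ℝ}
    (hsmooth : ∀ᶠ t : ℝ in atTop, ContDiff ℝ (zetaZeroCount T : ℕ) (g t))
    (hC : ∀ᶠ t : ℝ in atTop,
      (zetaZeroCount T : ℕ∞) ≤ {x : ℝ | 0 < x ∧ x ≤ T ∧ g t x = 0}.encard)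
    (hconv : ∀ k : ℕ, k ≤ zetaZeroCount T →
      TendstoUniformlyOn (fun t => iteratedDeriv k (g t))
        (iteratedDeriv k fun x : ℝ => (riemannXiUpper x).re) atTop (Icc 0 T)) :
    ∀ z : ℂ, riemannXiUpper z = 0 → 0 < z.re → z.re ≤ T → z.im = 0 := by
  classical
  set f : ℝ → ℝ := fun x => (riemannXiUpper x).re with hf
  set B := (xiZeros_finite T).toFinset with hB
  set Z : Finset ℝ := (B.filter fun z => z.im = 0).image Complex.re with hZ
  set k : ℝ → ℕ := fun c => analyticOrderNatAt riemannXiUpper (c : ℂ) with hk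
  have hΞreal := im_riemannXiUpper_ofReal_holds
  have hΞd := differentiable_riemannXiUpper'
  -- bookkeeping: the box sum is `N(T)`; its real part is `∑_{c ∈ Z} k c`
  have hsplit : ∑ z ∈ B, analyticOrderNatAt riemannXiUpper z
      = ∑ z ∈ B.filter (fun z => z.im = 0), analyticOrderNatAt riemannXiUpper z
        + ∑ z ∈ B.filter (fun z => ¬ z.im = 0), analyticOrderNatAt riemannXiUpper z :=
    (Finset.sum_filter_add_sum_filter_not B _ _).symm
  have hreal_sum : ∑ c ∈ Z, k c
      = ∑ z ∈ B.filter (fun z => z.im = 0), analyticOrderNatAt riemannXiUpper z := by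
    rw [hZ, Finset.sum_image]
    · refine Finset.sum_congr rfl fun z hz => ?_
      have hz0 : z.im = 0 := (Finset.mem_filter.mp hz).2
      simp only [k]
      congr 1
      exact Complex.ext (by simp) (by simp [hz0])
    · intro z hz w hw h
      have hz0 : z.im = 0 := (Finset.mem_filter.mp hz).2
      have hw0 : w.im = 0 := (Finset.mem_filter.mp hw).2
      exact Complex.ext h (by rw [hz0, hw0])
  -- every order `k c`, `c ∈ Z`, is at most `N(T)`
  have hkN : ∀ c ∈ Z, k c ≤ zetaZeroCount T := by
    intro c hc
    obtain ⟨z, hz, rfl⟩ := Finset.mem_image.mp hc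
    have hzB : z ∈ B := (Finset.mem_filter.mp hz).1
    have hz0 : z.im = 0 := (Finset.mem_filter.mp hz).2
    have hzre : ((z.re : ℝ) : ℂ) = z := Complex.ext (by simp) (by simp [hz0])
    rw [← sum_analyticOrderNatAt_eq_zetaZeroCount T, ← hB]
    simp only [k, hzre]
    exact Finset.single_le_sum (fun w _ => Nat.zero_le _) hzB
  -- the zeros of the limit on `[0, T]` lie in `Z`
  have hgzero : ∀ x ∈ Icc (0 : ℝ) T, f x = 0 → x ∈ Z := by
    intro x hx hfx
    have hΞx : riemannXiUpper x = 0 := Complex.ext (by simpa [f] using hfx) (by simpa using hΞreal x)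
    have hx0 : 0 < x := by
      rcases hx.1.eq_or_lt with h | h
      · exact absurd (show (x : ℂ).re = 0 by simp [← h]) (re_ne_zero_of_riemannXiUpper_eq_zero hΞx)
      · exact h
    refine Finset.mem_image.mpr ⟨(x : ℂ), Finset.mem_filter.mpr ⟨?_, by simp⟩, by simp⟩
    exact (Set.Finite.mem_toFinset _).mpr ⟨hΞx, by simpa using hx0, by simpa using hx.2⟩
  -- upper semicontinuity of the real zero count
  have hev : ∀ᶠ t : ℝ in atTop, {x | x ∈ Icc (0 : ℝ) T ∧ g t x = 0}.Finite ∧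
      {x | x ∈ Icc (0 : ℝ) T ∧ g t x = 0}.ncard ≤ ∑ c ∈ Z, k c := by
    refine eventually_ncard_zeros_le (N := zetaZeroCount T)
      (contDiff_re_ofReal (n := 0) hΞd).continuous hgzero ?_ ?_ hkN hsmooth
      (by simpa using hconv 0 (Nat.zero_le _)) ?_
    · intro c _
      exact ((contDiff_re_ofReal (n := ⊤) hΞd).continuous_iteratedDeriv
        (k c) (by exact_mod_cast le_top)).continuousAt
    · intro c _
      rw [iteratedDeriv_re_ofReal hΞd]
      have him := im_iteratedDeriv_ofReal_eq_zero hΞd hΞreal (k c) c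
      exact fun h => iteratedDeriv_analyticOrderNatAt_ne_zero (c : ℂ)
        (Complex.ext (by simpa using h) (by simpa using him))
    · intro c hc
      exact hconv (k c) (hkN c hc)
  obtain ⟨t, ⟨hfin, hle⟩, hcount⟩ := (hev.and hC).exists
  have hsub : {x : ℝ | 0 < x ∧ x ≤ T ∧ g t x = 0} ⊆ {x | x ∈ Icc (0 : ℝ) T ∧ g t x = 0} := by
    rintro x ⟨hx0, hxT, hgx⟩
    exact ⟨⟨hx0.le, hxT⟩, hgx⟩
  have hbound : ∑ z ∈ B, analyticOrderNatAt riemannXiUpper z ≤ ∑ c ∈ Z, k c := by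
    have h1 : (zetaZeroCount T : ℕ∞) ≤ ({x | x ∈ Icc (0 : ℝ) T ∧ g t x = 0}.ncard : ℕ∞) := by
      rw [hfin.cast_ncard_eq]
      exact hcount.trans (Set.encard_le_encard hsub)
    rw [hB, sum_analyticOrderNatAt_eq_zetaZeroCount]
    exact (by exact_mod_cast h1 : zetaZeroCount T ≤ _).trans hle
  have hzero_sum : ∑ z ∈ B.filter (fun z => ¬ z.im = 0), analyticOrderNatAt riemannXiUpper z = 0 := by
    have := hbound; rw [hsplit, ← hreal_sum] at this; omega
  intro z hz hz0 hzT
  by_contra hzim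
  have hzB : z ∈ B.filter (fun z => ¬ z.im = 0) :=
    Finset.mem_filter.mpr ⟨(Set.Finite.mem_toFinset _).mpr ⟨hz, hz0, hzT⟩, hzim⟩
  have h1 : 1 ≤ analyticOrderNatAt riemannXiUpper z := one_le_analyticOrderNatAt_of_zero hz
  have := Finset.single_le_sum (fun w _ => Nat.zero_le (analyticOrderNatAt riemannXiUpper w)) hzB
  omega

/-- **One window, lower count, neighbourhood form.** `F_t` entire and real on `ℝ`, real `c_t ≠ 0`,
`c_t F_t → Ξ` locally uniformly on an open `U ⊇ [0, T]`, and eventually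
`#{x ∈ (0, T] : F_t(x) = 0} ≥ N(T)`: then every zero of `Ξ` with `0 < Re z ≤ T` is real. -/
theorem im_eq_zero_of_countGe_of_nhds {F : ℝ → ℂ → ℂ} (hdiff : ∀ t, Differentiable ℂ (F t))
    (hreal : ∀ (t : ℝ) (x : ℝ), (F t x).im = 0) {c : ℝ → ℝ} (hc : ∀ t, c t ≠ 0)
    {T : ℝ} {U : Set ℂ} (hUo : IsOpen U) (hseg : ∀ x ∈ Icc (0 : ℝ) T, (x : ℂ) ∈ U)
    (hC : ∀ᶠ t : ℝ in atTop,
      (zetaZeroCount T : ℕ∞) ≤ {x : ℝ | 0 < x ∧ x ≤ T ∧ F t x = 0}.encard)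
    (hloc : TendstoLocallyUniformlyOn (fun t z => ((c t : ℝ) : ℂ) * F t z) riemannXiUpper atTop U) :
    ∀ z : ℂ, riemannXiUpper z = 0 → 0 < z.re → z.re ≤ T → z.im = 0 := by
  set Φ : ℝ → ℂ → ℂ := fun t z => ((c t : ℝ) : ℂ) * F t z with hΦ
  have hΦd : ∀ t, Differentiable ℂ (Φ t) := fun t => (differentiable_const _).mul (hdiff t)
  set g : ℝ → ℝ → ℝ := fun t x => (Φ t x).re with hg
  refine im_eq_zero_of_countGe_of_smoothConvergence (g := g)
    (Eventually.of_forall fun t => contDiff_re_ofReal (hΦd t)) ?_ ?_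
  · -- same real zeros: `c_t ≠ 0` and `F t x` is real
    filter_upwards [hC] with t ht
    have : {x : ℝ | 0 < x ∧ x ≤ T ∧ g t x = 0} = {x : ℝ | 0 < x ∧ x ≤ T ∧ F t x = 0} := by
      ext x
      simp only [mem_setOf_eq, g, Φ, Complex.re_ofReal_mul, mul_eq_zero, hc t, false_or]
      constructor
      · rintro ⟨h0, hT, h⟩
        exact ⟨h0, hT, Complex.ext (by simpa using h) (by simpa using hreal t x)⟩
      · rintro ⟨h0, hT, h⟩
        exact ⟨h0, hT, by simp [h]⟩
    rw [this]; exact ht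
  · intro k _
    have := tendstoUniformlyOn_re_iteratedDeriv hUo hΦd hloc hseg k
    rw [iteratedDeriv_re_ofReal differentiable_riemannXiUpper']
    refine this.congr (Eventually.of_forall fun t x _ => ?_)
    change (iteratedDeriv k (Φ t) x).re = iteratedDeriv k (g t) x
    rw [hg, iteratedDeriv_re_ofReal (hΦd t)]

/-- **RH from the LOWER count at unboundedly many windows and convergence near the axis.** `F_t`
entire and real on `ℝ`, real `c_t ≠ 0`; for every `T > 0` an open `U ⊇ [0, T]` on which
`c_t F_t → Ξ` locally uniformly; and for unboundedly many `T`, eventually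
`#{x ∈ (0, T] : F_t(x) = 0} ≥ N(T)`. Then the Riemann Hypothesis holds. G22-T
(`riemannHypothesis_of_count_of_thin`, SC-2 with `=`) is the special case of equality. -/
theorem riemannHypothesis_of_frequently_countGe_of_nhds {F : ℝ → ℂ → ℂ}
    (hdiff : ∀ t, Differentiable ℂ (F t)) (hreal : ∀ (t : ℝ) (x : ℝ), (F t x).im = 0)
    {c : ℝ → ℝ} (hc : ∀ t, c t ≠ 0)
    (hC : ∃ᶠ T : ℝ in atTop, ∀ᶠ t : ℝ in atTop,
      (zetaZeroCount T : ℕ∞) ≤ {x : ℝ | 0 < x ∧ x ≤ T ∧ F t x = 0}.encard)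
    (hconv : ∀ T : ℝ, 0 < T → ∃ U : Set ℂ, IsOpen U ∧ (∀ x ∈ Icc (0 : ℝ) T, (x : ℂ) ∈ U) ∧
      TendstoLocallyUniformlyOn (fun t z => ((c t : ℝ) : ℂ) * F t z) riemannXiUpper atTop U) :
    RiemannHypothesis := by
  have key : ∀ R : ℝ, ∀ z : ℂ, riemannXiUpper z = 0 → 0 < z.re → z.re ≤ R → z.im = 0 := by
    intro R z hz hz0 hzR
    obtain ⟨T, hTR, hCT⟩ := (hC.and_eventually (eventually_ge_atTop (max R 1))).exists
    have hT0 : 0 < T := lt_of_lt_of_le one_pos ((le_max_right _ _).trans hCT)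
    obtain ⟨U, hUo, hseg, hloc⟩ := hconv T hT0
    exact im_eq_zero_of_countGe_of_nhds hdiff hreal hc hUo hseg hTR hloc z hz hz0
      (hzR.trans ((le_max_left _ _).trans hCT))
  refine (riemannHypothesis_iff_im_eq_zero_of_riemannXiUpper_eq_zero_holds :
    RiemannHypothesis ↔ _).mpr fun z hz => ?_
  rcases lt_trichotomy z.re 0 with hre | hre | hre
  · have hz' : riemannXiUpper (-z) = 0 := by rw [riemannXiUpper_neg]; exact hz
    have := key ((-z).re) (-z) hz' (by simp; linarith) le_rfl
    simpa using this
  · exact absurd hre (re_ne_zero_of_riemannXiUpper_eq_zero hz)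
  · exact key z.re z hz hre le_rfl

/-- **RH from the LOWER count and idea-3's thin rectangles (even families).** `F_t` entire, real on
`ℝ`, even; `e^{-α_t} F_t → Ξ` uniformly on `[0, T] × [-δ, δ]` for every `T > 0` (SC-3, one `δ > 0`);
and for unboundedly many `T`, eventually `#{x ∈ (0, T] : F_t(x) = 0} ≥ N(T)` (lower SC-2). Then
the Riemann Hypothesis holds. -/
theorem riemannHypothesis_of_frequently_countGe_of_thin {F : ℝ → ℂ → ℂ}
    (hdiff : ∀ t, Differentiable ℂ (F t)) (hreal : ∀ (t : ℝ) (x : ℝ), (F t x).im = 0)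
    (heven : ∀ (t : ℝ) (z : ℂ), F t (-z) = F t z)
    (hC : ∃ᶠ T : ℝ in atTop, ∀ᶠ t : ℝ in atTop,
      (zetaZeroCount T : ℕ∞) ≤ {x : ℝ | 0 < x ∧ x ≤ T ∧ F t x = 0}.encard)
    (hT : ∃ δ : ℝ, 0 < δ ∧ ∃ α : ℝ → ℝ, ∀ T : ℝ, 0 < T →
      TendstoUniformlyOn (fun t z => ((Real.exp (-α t) : ℝ) : ℂ) * F t z) riemannXiUpper atTop
        (Icc 0 T ×ℂ Icc (-δ) δ)) :
    RiemannHypothesis := by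
  obtain ⟨δ, hδ, α, hconv⟩ := hT
  refine riemannHypothesis_of_frequently_countGe_of_nhds hdiff hreal (c := fun t => Real.exp (-α t))
    (fun t => (Real.exp_pos _).ne') hC fun T hT0 => ?_
  set Φ : ℝ → ℂ → ℂ := fun t z => ((Real.exp (-α t) : ℝ) : ℂ) * F t z with hΦ
  set R : Set ℂ := Icc 0 (T + 1) ×ℂ Icc (-δ) δ with hR
  have h : TendstoUniformlyOn Φ riemannXiUpper atTop R := hconv (T + 1) (by linarith)
  refine ⟨Ioo (-(T + 1)) (T + 1) ×ℂ Ioo (-δ) δ, isOpen_Ioo.reProdIm isOpen_Ioo, fun x hx =>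
    mem_reProdIm.mpr ⟨⟨by simp; linarith [hx.1], by simp; linarith [hx.2]⟩, by simp [hδ], by simp [hδ]⟩,
    ?_⟩
  have h' : TendstoUniformlyOn Φ riemannXiUpper atTop ((fun z : ℂ => -z) ⁻¹' R) := by
    have := h.comp (fun z : ℂ => -z)
    have hΦ' : (fun t => Φ t ∘ fun z : ℂ => -z) = Φ := by funext t z; simp [Φ, heven]
    have hΞ : (riemannXiUpper ∘ fun z : ℂ => -z) = riemannXiUpper := by
      funext z; simp [riemannXiUpper_neg]
    rwa [hΦ', hΞ] at this
  have hU : TendstoUniformlyOn Φ riemannXiUpper atTop (R ∪ (fun z : ℂ => -z) ⁻¹' R) := by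
    intro u hu
    filter_upwards [h u hu, h' u hu] with n hn hn' x hx
    exact hx.elim (hn x) (hn' x)
  refine (hU.mono ?_).tendstoLocallyUniformlyOn
  intro z hz
  obtain ⟨⟨hr1, hr2⟩, hi1, hi2⟩ := mem_reProdIm.mp hz
  rcases le_or_gt 0 z.re with hre | hre
  · exact Or.inl (mem_reProdIm.mpr ⟨⟨hre, hr2.le⟩, hi1.le, hi2.le⟩)
  · exact Or.inr (mem_reProdIm.mpr
      ⟨⟨by simp; exact hre.le, by simp; linarith⟩, by simp; linarith, by simp; linarith⟩)

/-! ## Sign changes: the certifiable form of the lower count -/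

/-- **`N` sign changes give `≥ N` zeros.** If `g : ℝ → ℝ` is continuous and `x : Fin (N+1) → ℝ` is
strictly increasing with `0 < x 0`, `x N ≤ T` and `g (x i) · g (x (i+1)) < 0` for every `i < N`, then
`#{y ∈ (0, T] : g(y) = 0} ≥ N` (one zero strictly between consecutive nodes, by the intermediate
value theorem; these zeros are distinct). This is the form of the lower count a census can certify at
a fixed `t` (interval arithmetic at the nodes). -/
theorem natCast_le_encard_zeros_of_sign_changes {g : ℝ → ℝ} (hg : Continuous g) {N : ℕ} {T : ℝ}
    (x : Fin (N + 1) → ℝ) (hx : StrictMono x) (hx0 : 0 < x 0) (hxT : x (Fin.last N) ≤ T)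
    (hsign : ∀ i : Fin N, g (x i.castSucc) * g (x i.succ) < 0) :
    (N : ℕ∞) ≤ {y : ℝ | 0 < y ∧ y ≤ T ∧ g y = 0}.encard := by
  -- a zero strictly between consecutive nodes
  have hz : ∀ i : Fin N, ∃ z, z ∈ Ioo (x i.castSucc) (x i.succ) ∧ g z = 0 := by
    intro i
    have hlt : x i.castSucc < x i.succ := hx Fin.castSucc_lt_succ
    have hs := hsign i
    rcases lt_or_gt_of_ne (show g (x i.castSucc) ≠ 0 from fun h => by simp [h] at hs) with ha | ha
    · -- g(x_i) < 0 < g(x_{i+1})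
      have hb : 0 < g (x i.succ) := by
        by_contra hb; push Not at hb
        exact absurd hs (not_lt.mpr (mul_nonneg_of_nonpos_of_nonpos ha.le hb))
      obtain ⟨z, hzI, hz⟩ := intermediate_value_Ioo hlt.le (hg.continuousOn) (show (0 : ℝ) ∈ Ioo (g (x i.castSucc)) (g (x i.succ)) from ⟨ha, hb⟩)
      exact ⟨z, hzI, hz⟩
    · -- g(x_i) > 0 > g(x_{i+1})
      have hb : g (x i.succ) < 0 := by
        by_contra hb; push Not at hb
        exact absurd hs (not_lt.mpr (mul_nonneg ha.le hb))
      obtain ⟨z, hzI, hz⟩ := intermediate_value_Ioo' hlt.le (hg.continuousOn) (show (0 : ℝ) ∈ Ioo (g (x i.succ)) (g (x i.castSucc)) from ⟨hb, ha⟩)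
      exact ⟨z, hzI, hz⟩
  choose z hzI hgz using hz
  -- the zeros are strictly increasing, hence distinct
  have hzmono : StrictMono z := by
    intro i j hij
    have hij' : (i : ℕ) < j := Fin.lt_def.mp hij
    have hle : x i.succ ≤ x j.castSucc := hx.monotone (Fin.le_iff_val_le_val.mpr (by
      simp only [Fin.val_succ, Fin.val_castSucc]; omega))
    calc z i < x i.succ := (hzI i).2
      _ ≤ x j.castSucc := hle
      _ < z j := (hzI j).1
  have hsub : Set.range z ⊆ {y : ℝ | 0 < y ∧ y ≤ T ∧ g y = 0} := by
    rintro _ ⟨i, rfl⟩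
    refine ⟨hx0.trans_le ((hx.monotone (Fin.zero_le _)).trans (hzI i).1.le), ?_, hgz i⟩
    exact (hzI i).2.le.trans ((hx.monotone (Fin.le_last _)).trans hxT)
  calc (N : ℕ∞) = (Set.range z).encard := by
        rw [← Set.image_univ, hzmono.injective.encard_image, Set.encard_univ]
        simp
    _ ≤ _ := Set.encard_le_encard hsub

/-- **RH from sign changes near the axis.** `F_t` entire and real on `ℝ`, real `c_t ≠ 0`, convergence
of `c_t F_t → Ξ` locally uniformly on an open `U ⊇ [0, T]` for every `T > 0`; and for unboundedly many
`T`, eventually in `t`, the real function `x ↦ Re F_t(x)` has `N(T)` sign changes at nodes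
`0 < x₀ < ⋯ < x_{N(T)} ≤ T`. Then the Riemann Hypothesis holds. -/
theorem riemannHypothesis_of_frequently_signChanges_of_nhds {F : ℝ → ℂ → ℂ}
    (hdiff : ∀ t, Differentiable ℂ (F t)) (hreal : ∀ (t : ℝ) (x : ℝ), (F t x).im = 0)
    {c : ℝ → ℝ} (hc : ∀ t, c t ≠ 0)
    (hS : ∃ᶠ T : ℝ in atTop, ∀ᶠ t : ℝ in atTop, ∃ x : Fin (zetaZeroCount T + 1) → ℝ,
      StrictMono x ∧ 0 < x 0 ∧ x (Fin.last _) ≤ T ∧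
        ∀ i : Fin (zetaZeroCount T), (F t (x i.castSucc)).re * (F t (x i.succ)).re < 0)
    (hconv : ∀ T : ℝ, 0 < T → ∃ U : Set ℂ, IsOpen U ∧ (∀ x ∈ Icc (0 : ℝ) T, (x : ℂ) ∈ U) ∧
      TendstoLocallyUniformlyOn (fun t z => ((c t : ℝ) : ℂ) * F t z) riemannXiUpper atTop U) :
    RiemannHypothesis := by
  refine riemannHypothesis_of_frequently_countGe_of_nhds hdiff hreal hc ?_ hconv
  refine hS.mono fun T hT => hT.mono fun t ⟨x, hx, hx0, hxT, hsign⟩ => ?_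
  have hcont : Continuous fun y : ℝ => (F t y).re :=
    Complex.continuous_re.comp ((hdiff t).continuous.comp Complex.continuous_ofReal)
  have h := natCast_le_encard_zeros_of_sign_changes hcont x hx hx0 hxT hsign
  refine h.trans (Set.encard_le_encard ?_)
  rintro y ⟨hy0, hyT, hy⟩
  exact ⟨hy0, hyT, Complex.ext (by simpa using hy) (by simpa using hreal t y)⟩

/-! Axiom census (expected `propext`, `Classical.choice`, `Quot.sound`). -/
#print axioms riemannHypothesis_of_frequently_countGe_of_thin
#print axioms riemannHypothesis_of_frequently_signChanges_of_nhds

end CountThin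

end Summit.RiemannHypothesis.RiemannHypothesis.Theorems

end
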